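import Summits.QuantumFields.YangMills.Theorems.ConvexGribovBodyBrascampLiebVacuumSCAbelianThirdHelpers
import Mathlib.LinearAlgebra.Matrix.FiniteDimensional

/-!
# Crux `BrascampLiebVacuumSC` (stmt-QuantumFields-16404), line `SketchIdeator1`, skeleton v8:
# the stub `stub_abelianThird` (abelian subalgebras of a simple compact Lie algebra are small)

Registered stub of skeleton v8 (`Cruxes/BrascampLiebVacuumSC/Lines/SketchIdeator1.lean`, lead c4),
proved verbatim. For a bracket-closed real subspace `L ⊆ 𝔲(N)` all of whose ideals are trivial and
with `dim L > 3`, GIVEN the real structure of `L_ℂ = span_ℂ L` (`hRS`) and, for every abelian `A ≤ L`,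
the weight decomposition `L_ℂ = ⨁_w E_w` under `ad A` (`hWD`), every abelian `A ≤ L` satisfies
`3 · dim A < dim L`. Classification-free root count (no maximal torus is needed):

1. `Φ = {w ≠ 0 : E_w ≠ 0}` is finite and symmetric (`E6`), so `Φ = R ⊔ (−R)` (`AbelianThird.exists_half`);
   the functionals in `R` separate the points of `A` (an `H` killed by all weights commutes with `L`
   by `E7`, hence spans an ideal, hence vanishes: `AbelianThird.centre_free`), so `dim A ≤ |R|`;
2. `dim L = dim_ℂ L_ℂ ≥ dim E_0 + Σ_Φ dim E_w ≥ dim A + 2|R| ≥ 3 dim A`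
   (`AbelianThird.finrank_biSup_eq_sum`, `span_ℂ A ≤ E_0`);
3. if `dim L ≤ 3 dim A` then `|R| = dim A ≥ 2`, every `β ∈ R` has a dual vector
   (`AbelianThird.exists_dual_vector`), so `±2β` and `γ ± β` (`γ ∈ Φ ∖ {±β}`) are not weights
   (`AbelianThird.not_weights`) and `P = E_β ⊔ E_{−β} ⊔ [E_β, E_{−β}]` is an ideal of `L_ℂ`
   (`AbelianThird.lie_mem_pairIdeal_of_mem_iSup`) missing `E_{β₂}` for `β₂ ∈ R ∖ {β}`
   (`AbelianThird.disjoint_pairIdeal`); its real form `L ⊓ P` is an ideal of `L`, non-zero (it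
   contains the real and imaginary parts of `0 ≠ Z ∈ E_β`) and proper — contradiction.

Helpers: `Theorems/ConvexGribovBodyBrascampLiebVacuumSCAbelianThirdHelpers.lean`. No named facts are
used.
-/

set_option autoImplicit false

open scoped BigOperators Matrix

namespace Summit.QuantumFields.YangMills.Theorems.BrascampLiebVacuumSC

/-- **Stub (LIE THEORY — abelian subalgebras of a simple compact Lie algebra are small:
`3·dim A < dim L`).** For `L ⊆ 𝔲(N)` bracket-closed with every ideal trivial and `dim L > 3`, and `A ≤ L`
abelian. Sketch (classification-free root count): enlarge `A` to a maximal abelian `A'` (self-centralising),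
decompose `L_ℂ = A'_ℂ ⊕ ⨁_{w ∈ Φ} E_w` (weight decomposition, given as hypothesis); `Φ = −Φ` (conjugation
`σ`) and `Φ` separates the points of `A'` (an `H` killed by all weights is central, and the centre is a proper
ideal), so `Φ` contains `k ≥ dim A'` pairs `±w` and `dim L = dim A' + Σ_Φ dim E_w ≥ 3 dim A'`. Equality would
force `k = dim A'`, i.e. representatives `β₁, …, β_a` forming a basis of `A'^*`; then `β₁ ± β_j ∉ Φ ∪ {0}`
(`j ≠ 1`) and `2β₁ ∉ Φ`, so `E_{β₁} ⊕ E_{−β₁} ⊕ [E_{β₁}, E_{−β₁}]` is a `σ`-stable ideal of `L_ℂ` whose real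
form is a proper non-zero ideal of `L` (`a ≥ 2` as `dim L > 3`) — contradiction. [cite: Knapp2002, Ch. II §4–5]
[cite: BrockerTomDieck1985, V (2.x) root-space decomposition] -/
theorem stub_abelianThird :
    ∀ (N : ℕ) (L : Submodule ℝ (Matrix (Fin N) (Fin N) ℂ)),
      (∀ X ∈ L, ∀ Y ∈ L, X * Y - Y * X ∈ L) → (∀ X ∈ L, star X = -X) →
        ((∀ W : Submodule ℝ (Matrix (Fin N) (Fin N) ℂ), (∀ X ∈ W, star X = -X) →
            Module.finrank ℂ ↥(Submodule.span ℂ (W : Set (Matrix (Fin N) (Fin N) ℂ))) = Module.finrank ℝ ↥W) ∧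
          (∀ Z ∈ Submodule.span ℂ (L : Set (Matrix (Fin N) (Fin N) ℂ)), ∃ X ∈ L, ∃ Y ∈ L, Z = X + Complex.I • Y) ∧
          (∀ X ∈ L, ∀ Y ∈ L, X + Complex.I • Y = 0 → X = 0 ∧ Y = 0)) →
        (∀ (A : Submodule ℝ (Matrix (Fin N) (Fin N) ℂ)), A ≤ L → (∀ H ∈ A, ∀ H' ∈ A, H * H' = H' * H) →
          ∃ E : (↥A →ₗ[ℝ] ℝ) → Submodule ℂ (Matrix (Fin N) (Fin N) ℂ),
            (∀ w, (E w : Set (Matrix (Fin N) (Fin N) ℂ)) =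
                {Z | Z ∈ Submodule.span ℂ (L : Set (Matrix (Fin N) (Fin N) ℂ)) ∧
                  ∀ H : ↥A, (H : Matrix (Fin N) (Fin N) ℂ) * Z - Z * (H : Matrix (Fin N) (Fin N) ℂ) =
                    ((((w H : ℝ) : ℂ)) * Complex.I) • Z}) ∧
            iSupIndep E ∧ (⨆ w, E w) = Submodule.span ℂ (L : Set (Matrix (Fin N) (Fin N) ℂ)) ∧
            {w | E w ≠ ⊥}.Finite ∧
            (∀ w w', ∀ Z ∈ E w, ∀ W ∈ E w', Z * W - W * Z ∈ E (w + w')) ∧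
            (∀ w, ∀ Z ∈ E w, -star Z ∈ E (-w)) ∧
            (∀ H : ↥A, (∀ w, E w ≠ ⊥ → w H = 0) → ∀ X ∈ L, (H : Matrix (Fin N) (Fin N) ℂ) * X = X * (H : Matrix (Fin N) (Fin N) ℂ))) →
        (∀ I : Submodule ℝ (Matrix (Fin N) (Fin N) ℂ), I ≤ L →
          (∀ X ∈ L, ∀ Y ∈ I, X * Y - Y * X ∈ I) → I = ⊥ ∨ I = L) →
        3 < Module.finrank ℝ ↥L →
        ∀ (A : Submodule ℝ (Matrix (Fin N) (Fin N) ℂ)), A ≤ L → (∀ H ∈ A, ∀ H' ∈ A, H * H' = H' * H) →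
          3 * Module.finrank ℝ ↥A < Module.finrank ℝ ↥L := by
  intro N L hbr hskew hRS hWD hsimple hdim A hAL hAab
  classical
  obtain ⟨hRS1, hRS2, -⟩ := hRS
  obtain ⟨E, hE1, hE2, hE3, hE4, hE5, hE6, hE7⟩ := hWD A hAL hAab
  /- (1) the finite symmetric set `Φ` of non-zero weights and its half `R` -/
  set Φ : Finset (↥A →ₗ[ℝ] ℝ) := hE4.toFinset.filter (fun w => w ≠ 0) with hΦdef
  have hΦ : ∀ w, w ∈ Φ ↔ E w ≠ ⊥ ∧ w ≠ 0 := fun w => by simp [hΦdef]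
  have hΦsymm : ∀ w ∈ Φ, -w ∈ Φ := by
    intro w hw
    rw [hΦ] at hw ⊢
    obtain ⟨Z, hZ, hZ0⟩ := (Submodule.ne_bot_iff _).1 hw.1
    exact ⟨(Submodule.ne_bot_iff _).2 ⟨-star Z, hE6 w Z hZ, by simpa using hZ0⟩, neg_ne_zero.2 hw.2⟩
  have hΦnz : ∀ w ∈ Φ, -w ≠ w := fun w hw h => ((hΦ w).1 hw).2 <| by
    ext H
    have h' := LinearMap.congr_fun h H
    simp only [LinearMap.neg_apply] at h'
    simp only [LinearMap.zero_apply]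
    linarith
  obtain ⟨R, hRΦ, hcov, hRdisj⟩ := AbelianThird.exists_half Φ hΦnz hΦsymm
  have hcardΦ : Φ.card = 2 * R.card := AbelianThird.card_eq_two_mul_card hΦsymm hRΦ hcov hRdisj
  /- (2) the functionals in `R` separate the points of `A` -/
  have hsep : ∀ H : ↥A, (∀ w ∈ R, w H = 0) → H = 0 := by
    intro H hH
    have hall : ∀ w, E w ≠ ⊥ → w H = 0 := by
      intro w hw
      by_cases hw0 : w = 0
      · simp [hw0]
      rcases hcov w ((hΦ w).2 ⟨hw, hw0⟩) with h | h
      · exact hH w h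
      · simpa using hH (-w) h
    exact Subtype.ext (AbelianThird.centre_free hsimple hdim (hAL H.2) (hE7 H hall))
  /- (3) counting: `dim A ≤ |R|` and `dim A + 2 |R| ≤ dim E_0 + |Φ| ≤ dim L` -/
  have haR : Module.finrank ℝ ↥A ≤ R.card := AbelianThird.finrank_le_card R hsep
  have hdL := hRS1 L hskew
  have hdA := hRS1 A (fun X hX => hskew X (hAL hX))
  have h0Φ : (0 : ↥A →ₗ[ℝ] ℝ) ∉ Φ := by simp [hΦ]
  have hcount : Module.finrank ℂ ↥(E 0) + Φ.card ≤ Module.finrank ℝ ↥L := by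
    have h1 : Module.finrank ℂ ↥(⨆ w ∈ insert 0 Φ, E w) ≤
        Module.finrank ℂ ↥(Submodule.span ℂ (L : Set (Matrix (Fin N) (Fin N) ℂ))) := by
      apply Submodule.finrank_mono
      rw [← hE3]
      exact iSup₂_le fun w _ => le_iSup E w
    rw [AbelianThird.finrank_biSup_eq_sum hE2, Finset.sum_insert h0Φ, hdL] at h1
    have h2 : Φ.card ≤ ∑ w ∈ Φ, Module.finrank ℂ ↥(E w) := by
      have := Finset.card_nsmul_le_sum Φ (fun w => Module.finrank ℂ ↥(E w)) 1
        (fun w hw => Submodule.one_le_finrank_iff.2 ((hΦ w).1 hw).1)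
      simpa using this
    omega
  have hE0 : Module.finrank ℝ ↥A ≤ Module.finrank ℂ ↥(E 0) :=
    hdA ▸ Submodule.finrank_mono (AbelianThird.span_le_weightZero hAL hAab hE1)
  by_contra hcon
  have hRa : R.card ≤ Module.finrank ℝ ↥A := by omega
  obtain ⟨β, hβ, β₂, hβ₂, hββ₂⟩ := Finset.one_lt_card.1 (show 1 < R.card by omega)
  /- (4) the dual vector of `β` and the excluded weights -/
  obtain ⟨H₀, hβH₀, hH₀⟩ := AbelianThird.exists_dual_vector R hsep hRa β hβ
  have hP : ∀ w, E w ≠ ⊥ → w ≠ β → w ≠ -β → w H₀ = 0 := by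
    intro w hw hwβ hwnβ
    by_cases hw0 : w = 0
    · simp [hw0]
    rcases hcov w ((hΦ w).2 ⟨hw, hw0⟩) with h | h
    · exact hH₀ w h hwβ
    · simpa using hH₀ (-w) h (fun h' => hwnβ (by rw [← h', neg_neg]))
  obtain ⟨hF2, hF2', hF1⟩ := AbelianThird.not_weights (fun w => E w ≠ ⊥) β H₀ hβH₀ hP
  simp only [not_ne_iff] at hF2 hF2' hF1
  /- (5) the ideal `P = I_ℂ` of `L_ℂ` and its real form `I` -/
  set P : Submodule ℂ (Matrix (Fin N) (Fin N) ℂ) := E β ⊔ E (-β) ⊔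
    Submodule.span ℂ {T | ∃ Z ∈ E β, ∃ W ∈ E (-β), T = Z * W - W * Z} with hP
  have hideal : ∀ X ∈ L, ∀ T ∈ P, X * T - T * X ∈ P :=
    fun X hX T hT => AbelianThird.lie_mem_pairIdeal_of_mem_iSup E β hP hE5 hF2 hF2' hF1
      (by rw [hE3]; exact Submodule.subset_span hX) T hT
  let I : Submodule ℝ (Matrix (Fin N) (Fin N) ℂ) := L ⊓ P.restrictScalars ℝ
  have hIideal : ∀ X ∈ L, ∀ Y ∈ I, X * Y - Y * X ∈ I := fun X hX Y hY =>
    ⟨hbr X hX Y hY.1, hideal X hX Y hY.2⟩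
  rcases hsimple I inf_le_left hIideal with hI | hI
  · /- `I = ⊥` is impossible: the real and imaginary parts of `0 ≠ Z ∈ E β` lie in `I` -/
    obtain ⟨Z, hZ, hZ0⟩ := (Submodule.ne_bot_iff _).1 ((hΦ β).1 (hRΦ hβ)).1
    have hZL : Z ∈ Submodule.span ℂ (L : Set (Matrix (Fin N) (Fin N) ℂ)) := by
      rw [← hE3]; exact Submodule.mem_iSup_of_mem β hZ
    obtain ⟨X, hX, Y, hY, rfl⟩ := hRS2 Z hZL
    have hZI : X + Complex.I • Y ∈ P := AbelianThird.mem_pairIdeal_left E β hP hZ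
    have hσ : -star (X + Complex.I • Y) ∈ P := AbelianThird.mem_pairIdeal_right E β hP (hE6 β _ hZ)
    have hstar : -star (X + Complex.I • Y) = X - Complex.I • Y := by
      rw [star_add, star_smul, hskew X hX, hskew Y hY, Complex.star_def, Complex.conj_I, neg_add,
        neg_neg, neg_smul, neg_neg, smul_neg, sub_eq_add_neg]
    rw [hstar] at hσ
    have hmemI : ∀ {T}, T ∈ L → T ∈ P → T = 0 := fun hT hT' => by
      have h : _ ∈ I := ⟨hT, hT'⟩
      rw [hI] at h
      exact (Submodule.mem_bot ℝ).1 h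
    have hX0 : X = 0 := by
      refine hmemI hX ?_
      have h := Submodule.smul_mem _ (2⁻¹ : ℂ) (Submodule.add_mem _ hZI hσ)
      rwa [show X + Complex.I • Y + (X - Complex.I • Y) = (2 : ℂ) • X by rw [two_smul]; abel,
        smul_smul, inv_mul_cancel₀ (two_ne_zero), one_smul] at h
    have hY0 : Y = 0 := by
      refine hmemI hY ?_
      have h := Submodule.smul_mem _ ((2 * Complex.I)⁻¹ : ℂ) (Submodule.sub_mem _ hZI hσ)
      rwa [show X + Complex.I • Y - (X - Complex.I • Y) = (2 * Complex.I) • Y by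
          rw [mul_smul, two_smul]; abel,
        smul_smul, inv_mul_cancel₀ (mul_ne_zero two_ne_zero Complex.I_ne_zero), one_smul] at h
    exact hZ0 (by rw [hX0, hY0]; simp)
  · /- `I = L` is impossible: then `L_ℂ ≤ I_ℂ`, but `I_ℂ` misses `E β₂ ≠ ⊥` -/
    obtain ⟨hEβ₂, hβ₂0⟩ := (hΦ β₂).1 (hRΦ hβ₂)
    have hLI : Submodule.span ℂ (L : Set (Matrix (Fin N) (Fin N) ℂ)) ≤ P := by
      rw [Submodule.span_le]
      intro X hX
      have h : X ∈ I := by rw [hI]; exact hX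
      exact h.2
    refine hEβ₂ ((AbelianThird.disjoint_pairIdeal E β hP hE5 hE2 (Ne.symm hββ₂)
      (fun h => hRdisj β hβ (h ▸ hβ₂)) hβ₂0).eq_bot_of_le ?_)
    calc E β₂ ≤ ⨆ w, E w := le_iSup E β₂
      _ = _ := hE3
      _ ≤ _ := hLI

end Summit.QuantumFields.YangMills.Theorems.BrascampLiebVacuumSC
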